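import Mathlib
import Literature.Probability.Moments.EfronSteinProofs
import Literature.Probability.Process.CondExpProductFibre
import HarnessLib

/-!
# Efron–Stein in conditional-variance form on a finite product of copies of a probability space,
# and the Holley–Stroock comparison of one heat-bath term
# (helper for crux `UnitSamplerGap`, stmt-QuantumFields-28042, route `SamplerStability`, LINE 11 «holley_stroock»)

Route-independent helper file (imports Mathlib + two Literature modules only; no definitions).  For a probability
space `(X, ρ)`, a finite index type `ι`, `π = ρ^{⊗ι} = Measure.pi (fun _ => ρ)` and the σ-algebras
`σ(ω_b, b ≠ i) = MeasurableSpace.comap (fun ω (b : {b // b ≠ i}) => ω b.1) MeasurableSpace.pi`: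

* §2 `map_update_pi_prod`, `integral_pi_eq_integral_integral_update` — resampling one coordinate from an independent
  copy preserves `π` (disintegration of `π` along one coordinate); `map_eval_restrict_pi` — the joint law of
  `(ω i, ω|_{b ≠ i})` is `ρ ⊗ ρ^{⊗{b ≠ i}}`; `condExp_pi_ae_eq_integral_update` — `π[g | σ(ω_b, b ≠ i)] = ∫ g(ω[i ↦ a]) dρ(a)`
  a.e. (the tree's `Literature.Probability.Process.condExp_comap_ae_eq_integral_comp_recon`, Kallenberg FMP Thm 6.4);
  `half_integral_sq_sub_update_eq` — `½ E(Z − Z_i')² = ∫ g² − ∫ (π[g | σ(ω_b, b ≠ i)])²`; hence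
  ★ `variance_pi_le_sum_condVar` — **Efron–Stein, conditional form** (Boucheron–Bousquet–Lugosi 2004 §2 Thm 4)
  `Var_π(g) ≤ Σ_i (∫ g² dπ − ∫ (π[g | σ(ω_b, b ≠ i)])² dπ)` for `g ∈ L²(π)` strongly measurable, from the tree's
  resampling form `Literature.Probability.Moments.EfronSteinInequality_holds` (ibid. Thm 5).
* §3 `integral_le_exp_mul_integral_of_le_smul` and ★ `condVar_integral_le_exp_mul` — **Holley–Stroock for one
  heat-bath term**: if `π ≤ e^{b} μ` then `∫ g² dπ − ∫ (π[g|m])² dπ ≤ e^{b} (∫ g² dμ − ∫ (μ[g|m])² dμ)` for every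
  sub-σ-algebra `m` (the conditional expectation is the `L²`-closest `m`-measurable function).

Cell `ym-idea-1` width seat `ym-line-sfw-p2-w3` g29 (free hands), following planner ym-idea-5 g15's LANDABLE-NOW-g15 §4.5.
HONEST FRAMING: helper lemmas only; no crux, rung or summit is proved; the YM mass gap is NOT proved.
-/

noncomputable section

open MeasureTheory ProbabilityTheory Filter Set Function
open scoped ENNReal

namespace Summit.QuantumFields.YangMills.Theorems.UnitSamplerGap

/-! ### §1 Generic `L²` facts about conditional expectations (private plumbing)

These three lemmas have public twins in the tree (`…SusceptibilityToPoincare.TwoBlock.integral_sub_condExp_sq`,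
`…RgVarianceCascade.PinnedGlauber.integral_sub_condExp_sq_le_integral_sub_sq`), which live in modules importing the
route file `Theses.FradkinShenkerFlow`; they are re-proved here as PRIVATE lemmas so that this route-independent helper
does not enter that route's cone (lint `theses-cone`). -/

section CondExpL2

variable {Ω : Type*} {m m0 : MeasurableSpace Ω} {μ : Measure Ω}

/-- `∫ g · μ[g|m] dμ = ∫ (μ[g|m])² dμ` for `g ∈ L²(μ)` (pull-out property). [folklore] -/
private theorem integral_mul_condExp (hm : m ≤ m0) [IsFiniteMeasure μ] {g : Ω → ℝ} (hg : MemLp g 2 μ) :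
    ∫ ω, g ω * (μ[g|m]) ω ∂μ = ∫ ω, (μ[g|m]) ω ^ 2 ∂μ := by
  have hgi : Integrable g μ := hg.integrable one_le_two
  have hP : MemLp (μ[g|m]) 2 μ := hg.condExp one_le_two
  have hPg : Integrable (μ[g|m] * g) μ := hP.integrable_mul hg
  have h1 : μ[μ[g|m] * g|m] =ᵐ[μ] μ[g|m] * μ[g|m] :=
    condExp_mul_of_stronglyMeasurable_left stronglyMeasurable_condExp hPg hgi
  calc ∫ ω, g ω * (μ[g|m]) ω ∂μ = ∫ ω, (μ[g|m] * g) ω ∂μ := by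
        refine integral_congr_ae (Eventually.of_forall fun ω => ?_); simp only [Pi.mul_apply]; ring
    _ = ∫ ω, (μ[μ[g|m] * g|m]) ω ∂μ := (integral_condExp hm).symm
    _ = ∫ ω, (μ[g|m] * μ[g|m]) ω ∂μ := integral_congr_ae h1
    _ = ∫ ω, (μ[g|m]) ω ^ 2 ∂μ := by
        refine integral_congr_ae (Eventually.of_forall fun ω => ?_); simp only [Pi.mul_apply]; ring

/-- PYTHAGORAS for the conditional expectation in `L²`: `∫ (g − μ[g|m])² = ∫ g² − ∫ (μ[g|m])²`. [folklore] -/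
private theorem integral_sub_condExp_sq (hm : m ≤ m0) [IsFiniteMeasure μ] {g : Ω → ℝ} (hg : MemLp g 2 μ) :
    ∫ ω, (g ω - (μ[g|m]) ω) ^ 2 ∂μ = (∫ ω, g ω ^ 2 ∂μ) - ∫ ω, (μ[g|m]) ω ^ 2 ∂μ := by
  have hP : MemLp (μ[g|m]) 2 μ := hg.condExp one_le_two
  have hgg : Integrable (fun ω => g ω ^ 2) μ := hg.integrable_sq
  have hPP : Integrable (fun ω => (μ[g|m]) ω ^ 2) μ := hP.integrable_sq
  have hgP : Integrable (fun ω => g ω * (μ[g|m]) ω) μ := hg.integrable_mul hP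
  have hpt : (fun ω => (g ω - (μ[g|m]) ω) ^ 2)
      = fun ω => (g ω ^ 2 + (μ[g|m]) ω ^ 2) - 2 * (g ω * (μ[g|m]) ω) := by
    funext ω; ring
  have hF : Integrable (fun ω => g ω ^ 2 + (μ[g|m]) ω ^ 2) μ := hgg.add hPP
  have hG : Integrable (fun ω => 2 * (g ω * (μ[g|m]) ω)) μ := hgP.const_mul 2
  rw [hpt, integral_sub hF hG, integral_add hgg hPP, integral_const_mul, integral_mul_condExp hm hg]
  ring

/-- The conditional expectation is the `L²`-CLOSEST `m`-measurable function:
`∫ (g − μ[g|m])² ≤ ∫ (g − h)²` for every `m`-strongly-measurable `h ∈ L²(μ)`. [folklore] -/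
private theorem integral_sub_condExp_sq_le (hm : m ≤ m0) [IsFiniteMeasure μ] {g h : Ω → ℝ} (hg : MemLp g 2 μ)
    (hhm : StronglyMeasurable[m] h) (hh : MemLp h 2 μ) :
    ∫ ω, (g ω - (μ[g|m]) ω) ^ 2 ∂μ ≤ ∫ ω, (g ω - h ω) ^ 2 ∂μ := by
  have hgi : Integrable g μ := hg.integrable one_le_two
  have hP : MemLp (μ[g|m]) 2 μ := hg.condExp one_le_two
  -- the `m`-measurable direction `k = μ[g|m] − h`
  have hk : MemLp (μ[g|m] - h) 2 μ := hP.sub hh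
  have hksm : StronglyMeasurable[m] (μ[g|m] - h) := stronglyMeasurable_condExp.sub hhm
  have hkg : Integrable ((μ[g|m] - h) * g) μ := hk.integrable_mul hg
  have hkP : Integrable ((μ[g|m] - h) * μ[g|m]) μ := hk.integrable_mul hP
  -- orthogonality `∫ (g − μ[g|m]) k = 0`
  have horth : ∫ ω, ((μ[g|m] - h) * g) ω ∂μ = ∫ ω, ((μ[g|m] - h) * μ[g|m]) ω ∂μ := by
    rw [← integral_condExp hm (μ := μ) (f := (μ[g|m] - h) * g)]
    exact integral_congr_ae (condExp_mul_of_stronglyMeasurable_left hksm hkg hgi)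
  have hA : Integrable (fun ω => (g ω - (μ[g|m]) ω) ^ 2) μ := (hg.sub hP).integrable_sq
  have hB : Integrable (fun ω => ((μ[g|m]) ω - h ω) ^ 2) μ := hk.integrable_sq
  have hsplit : (fun ω => (g ω - h ω) ^ 2) = fun ω => ((g ω - (μ[g|m]) ω) ^ 2 + ((μ[g|m]) ω - h ω) ^ 2)
      + 2 * (((μ[g|m] - h) * g) ω - ((μ[g|m] - h) * μ[g|m]) ω) := by
    funext ω; simp only [Pi.mul_apply, Pi.sub_apply]; ring
  have hF : Integrable (fun ω => (g ω - (μ[g|m]) ω) ^ 2 + ((μ[g|m]) ω - h ω) ^ 2) μ := hA.add hB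
  have hD : Integrable (fun ω => ((μ[g|m] - h) * g) ω - ((μ[g|m] - h) * μ[g|m]) ω) μ := hkg.sub hkP
  have hG : Integrable (fun ω => 2 * (((μ[g|m] - h) * g) ω - ((μ[g|m] - h) * μ[g|m]) ω)) μ :=
    hD.const_mul 2
  rw [hsplit, integral_add hF hG, integral_add hA hB, integral_const_mul, integral_sub hkg hkP, horth,
    sub_self, mul_zero, add_zero]
  have hnn : 0 ≤ ∫ ω, ((μ[g|m]) ω - h ω) ^ 2 ∂μ := integral_nonneg fun ω => sq_nonneg _
  linarith

end CondExpL2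

/-! ### §2 One-coordinate resampling on a finite product of copies of a probability space -/

section Product

variable {ι : Type*} [Fintype ι] [DecidableEq ι] {X : Type*} [MeasurableSpace X]
  (ρ : Measure X) [IsProbabilityMeasure ρ]

/-- Resampling the coordinate `i` of `π = ρ^{⊗ι}` from an independent copy preserves `π`:
`(π ⊗ ρ) ∘ ((z, s) ↦ z[i ↦ s])⁻¹ = π`. [folklore] -/
-- adapted from the private `map_update_pi_prod` of Literature/Probability/Distributions/GaussianInterpolationFormula.lean
theorem map_update_pi_prod (i : ι) :
    ((Measure.pi fun _ : ι => ρ).prod ρ).map (fun p : (ι → X) × X => Function.update p.1 i p.2) =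
      Measure.pi fun _ : ι => ρ := by
  symm
  refine Measure.pi_eq fun A hA => ?_
  rw [Measure.map_apply measurable_update' (MeasurableSet.univ_pi hA)]
  have hpre : (fun p : (ι → X) × X => Function.update p.1 i p.2) ⁻¹' Set.pi univ A =
      (Set.pi univ (Function.update A i univ)) ×ˢ A i := by
    ext ⟨z, s⟩
    simp only [Set.mem_preimage, Set.mem_univ_pi, Set.mem_prod]
    constructor
    · intro h
      refine ⟨fun j => ?_, by simpa using h i⟩
      by_cases hj : j = i
      · subst hj; simp
      · rw [Function.update_of_ne hj]
        simpa [Function.update_of_ne hj] using h j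
    · rintro ⟨h1, h2⟩ j
      by_cases hj : j = i
      · subst hj; simpa using h2
      · rw [Function.update_of_ne hj]
        simpa [Function.update_of_ne hj] using h1 j
  rw [hpre, Measure.prod_prod, Measure.pi_pi]
  have hfun : (fun j => ρ (Function.update A i univ j)) = Function.update (fun j => ρ (A j)) i (ρ univ) := by
    funext j
    by_cases hj : j = i
    · subst hj; simp
    · simp [Function.update_of_ne hj]
  rw [show (∏ j, ρ (Function.update A i univ j)) = ∏ j, (fun j => ρ (Function.update A i univ j)) j
      from rfl, hfun, Finset.prod_update_of_mem (Finset.mem_univ i), measure_univ, one_mul,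
    Finset.sdiff_singleton_eq_erase, Finset.prod_erase_mul _ _ (Finset.mem_univ i)]

/-- Integrability of `(z, s) ↦ F(z[i ↦ s])` under `π ⊗ ρ` for `π`-integrable `F`. [folklore] -/
theorem integrable_comp_update (i : ι) {E : Type*} [NormedAddCommGroup E] {F : (ι → X) → E}
    (hF : Integrable F (Measure.pi fun _ : ι => ρ)) :
    Integrable (fun p : (ι → X) × X => F (Function.update p.1 i p.2)) ((Measure.pi fun _ : ι => ρ).prod ρ) := by
  have hmeas : Measurable (fun p : (ι → X) × X => Function.update p.1 i p.2) := measurable_update'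
  have hmap := map_update_pi_prod ρ i
  have hFm : AEStronglyMeasurable F
      (((Measure.pi fun _ : ι => ρ).prod ρ).map fun p : (ι → X) × X => Function.update p.1 i p.2) := by
    rw [hmap]; exact hF.aestronglyMeasurable
  exact (integrable_map_measure hFm hmeas.aemeasurable).1 (by rw [hmap]; exact hF)

/-- **Disintegration of `π = ρ^{⊗ι}` along one coordinate**: `∫ F dπ = ∫ (∫ F(z[i ↦ s]) dρ(s)) dπ(z)` for
`π`-integrable `F`. [folklore] -/
-- adapted from the private `integral_pi_update` of Literature/Probability/Distributions/GaussianInterpolationFormula.lean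
theorem integral_pi_eq_integral_integral_update (i : ι) {E : Type*} [NormedAddCommGroup E] [NormedSpace ℝ E]
    {F : (ι → X) → E} (hF : Integrable F (Measure.pi fun _ : ι => ρ)) :
    ∫ z, F z ∂Measure.pi (fun _ : ι => ρ) =
      ∫ z, (∫ s, F (Function.update z i s) ∂ρ) ∂Measure.pi (fun _ : ι => ρ) := by
  have hmeas : Measurable (fun p : (ι → X) × X => Function.update p.1 i p.2) := measurable_update'
  have hmap := map_update_pi_prod ρ i
  have hFm : AEStronglyMeasurable F
      (((Measure.pi fun _ : ι => ρ).prod ρ).map fun p : (ι → X) × X => Function.update p.1 i p.2) := by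
    rw [hmap]; exact hF.aestronglyMeasurable
  calc ∫ z, F z ∂Measure.pi (fun _ : ι => ρ)
      = ∫ z, F z ∂(((Measure.pi fun _ : ι => ρ).prod ρ).map fun p : (ι → X) × X => Function.update p.1 i p.2) := by
        rw [hmap]
    _ = ∫ p, F (Function.update p.1 i p.2) ∂((Measure.pi fun _ : ι => ρ).prod ρ) := integral_map hmeas.aemeasurable hFm
    _ = ∫ z, ∫ s, F (Function.update z i s) ∂ρ ∂Measure.pi (fun _ : ι => ρ) :=
        integral_prod _ (integrable_comp_update ρ i hF)

/-- Splitting `π = ρ^{⊗ι}` into the coordinate `i` and the remaining ones: the joint law of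
`(ω i, ω|_{b ≠ i})` under `π` is the product `ρ ⊗ ρ^{⊗{b ≠ i}}`. [folklore] -/
theorem map_eval_restrict_pi (i : ι) :
    (Measure.pi fun _ : ι => ρ).map (fun ω : ι → X => (ω i, fun b : {b : ι // b ≠ i} => ω b.1))
      = ρ.prod (Measure.pi fun _ : {b : ι // b ≠ i} => ρ) := by
  letI hF1 : Fintype {b : ι // b = i} := Subtype.fintype fun b => b = i
  letI hF2 : Fintype {b : ι // ¬ b = i} := Subtype.fintype fun b => ¬ b = i
  have he := measurePreserving_piEquivPiSubtypeProd (fun _ : ι => ρ) (fun b => b = i)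
  have hev : MeasurePreserving (Function.eval (⟨i, rfl⟩ : {b : ι // b = i}))
      (Measure.pi fun _ : {b : ι // b = i} => ρ) ρ := measurePreserving_eval (fun _ : {b : ι // b = i} => ρ) _
  have hid : MeasurePreserving (id : ({b : ι // ¬ b = i} → X) → ({b : ι // ¬ b = i} → X))
      (Measure.pi fun _ => ρ) (Measure.pi fun _ => ρ) := MeasurePreserving.id _
  have hcomp := (hev.prod hid).comp he
  have hfun : (Prod.map (Function.eval (⟨i, rfl⟩ : {b : ι // b = i})) id) ∘
      (MeasurableEquiv.piEquivPiSubtypeProd (fun _ : ι => X) (fun b => b = i))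
      = fun ω : ι → X => (ω i, fun b : {b : ι // b ≠ i} => ω b.1) := by
    funext ω; rfl
  rw [hfun] at hcomp
  exact hcomp.map_eq

omit [Fintype ι] [DecidableEq ι] in
/-- The σ-algebra of the coordinates other than `i` is a sub-σ-algebra of the product σ-algebra. [folklore] -/
theorem comap_restrict_le (i : ι) :
    MeasurableSpace.comap (fun (ω : ι → X) (b : {b : ι // b ≠ i}) => ω b.1) MeasurableSpace.pi
      ≤ (MeasurableSpace.pi : MeasurableSpace (ι → X)) :=
  (measurable_pi_lambda _ fun b => measurable_pi_apply b.1).comap_le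

/-- **Conditional expectation given the other coordinates = resampling the coordinate**: under
`π = ρ^{⊗ι}`, `π[g | σ(ω_b, b ≠ i)] (ω) = ∫ g(ω[i ↦ a]) dρ(a)` for `π`-a.e. `ω` (Kallenberg FMP Thm 6.4 in the
independent case, via the tree's `condExp_comap_ae_eq_integral_comp_recon`). [folklore] -/
theorem condExp_pi_ae_eq_integral_update (i : ι) {g : (ι → X) → ℝ} (hgm : StronglyMeasurable g)
    (hgi : Integrable g (Measure.pi fun _ : ι => ρ)) :
    (Measure.pi fun _ : ι => ρ)[g | MeasurableSpace.comap (fun (ω : ι → X) (b : {b : ι // b ≠ i}) => ω b.1)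
        MeasurableSpace.pi]
      =ᵐ[Measure.pi fun _ : ι => ρ] fun ω => ∫ a, g (Function.update ω i a) ∂ρ := by
  have hT : Measurable (fun ω : ι → X => ω i) := measurable_pi_apply i
  have hS : Measurable (fun (ω : ι → X) (b : {b : ι // b ≠ i}) => ω b.1) :=
    measurable_pi_lambda _ fun b => measurable_pi_apply b.1
  set R : X × ({b : ι // b ≠ i} → X) → (ι → X) := fun p b => if h : b = i then p.1 else p.2 ⟨b, h⟩ with hRdef
  have hR : Measurable R := by
    refine measurable_pi_lambda _ fun b => ?_
    by_cases h : b = i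
    · have : (fun p : X × ({b : ι // b ≠ i} → X) => R p b) = fun p => p.1 := by
        funext p; simp [hRdef, h]
      rw [this]; exact measurable_fst
    · have : (fun p : X × ({b : ι // b ≠ i} → X) => R p b) = fun p => p.2 ⟨b, h⟩ := by
        funext p; simp [hRdef, h]
      rw [this]; exact (measurable_pi_apply _).comp measurable_snd
  have hupd : ∀ (ω : ι → X) (a : X), R (a, fun b : {b : ι // b ≠ i} => ω b.1) = Function.update ω i a := by
    intro ω a; funext b
    by_cases h : b = i
    · subst h; simp [hRdef]
    · simp [hRdef, h]
  have hRTS : ∀ ω : ι → X, R (ω i, fun b : {b : ι // b ≠ i} => ω b.1) = ω := by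
    intro ω; rw [hupd]; exact Function.update_eq_self i ω
  have key := Literature.Probability.Process.condExp_comap_ae_eq_integral_comp_recon
    (μ := Measure.pi fun _ : ι => ρ) (ν := ρ) (π := Measure.pi fun _ : {b : ι // b ≠ i} => ρ)
    hT hS (map_eval_restrict_pi ρ i) hR hRTS hgm hgi
  refine key.trans (Eventually.of_forall fun ω => ?_)
  simp only [hupd]

/-- **Resampling sensitivity = twice the conditional variance**: for `g ∈ L²(π)`,
`½ ∫∫ (g(x) − g(x[i ↦ y]))² dρ(y) dπ(x) = ∫ g² dπ − ∫ (π[g | σ(ω_b, b ≠ i)])² dπ`. [folklore] -/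
theorem half_integral_sq_sub_update_eq (i : ι) {g : (ι → X) → ℝ} (hgm : StronglyMeasurable g)
    (hg : MemLp g 2 (Measure.pi fun _ : ι => ρ)) :
    (1 / 2 : ℝ) * ∫ x, (∫ y, (g x - g (Function.update x i y)) ^ 2 ∂ρ) ∂Measure.pi (fun _ : ι => ρ)
      = (∫ x, g x ^ 2 ∂Measure.pi (fun _ : ι => ρ))
        - ∫ x, ((Measure.pi fun _ : ι => ρ)[g | MeasurableSpace.comap
            (fun (ω : ι → X) (b : {b : ι // b ≠ i}) => ω b.1) MeasurableSpace.pi]) x ^ 2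
          ∂Measure.pi (fun _ : ι => ρ) := by
  set π : Measure (ι → X) := Measure.pi fun _ : ι => ρ with hπ
  set A : (ι → X) → ℝ := fun x => ∫ y, g (Function.update x i y) ∂ρ with hAdef
  have hgi : Integrable g π := hg.integrable one_le_two
  have hg2 : Integrable (fun x => g x ^ 2) π := hg.integrable_sq
  have h1 : ∀ᵐ x ∂π, Integrable (fun y => g (Function.update x i y)) ρ :=
    (integrable_comp_update ρ i hgi).prod_right_ae
  have h2 : ∀ᵐ x ∂π, Integrable (fun y => g (Function.update x i y) ^ 2) ρ :=
    (integrable_comp_update ρ i hg2).prod_right_ae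
  have hpt : ∀ᵐ x ∂π, ∫ y, (g x - g (Function.update x i y)) ^ 2 ∂ρ
      = (g x ^ 2 - 2 * (g x * A x)) + ∫ y, g (Function.update x i y) ^ 2 ∂ρ := by
    filter_upwards [h1, h2] with x h1 h2
    have hsplit : (fun y => (g x - g (Function.update x i y)) ^ 2)
        = fun y => (g x ^ 2 - 2 * (g x * g (Function.update x i y))) + g (Function.update x i y) ^ 2 := by
      funext y; ring
    have hI1 : Integrable (fun y => 2 * (g x * g (Function.update x i y))) ρ := (h1.const_mul (g x)).const_mul 2
    have hI0 : Integrable (fun y => g x ^ 2 - 2 * (g x * g (Function.update x i y))) ρ :=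
      (integrable_const _).sub hI1
    rw [hsplit, integral_add hI0 h2, integral_sub (integrable_const _) hI1, integral_const_mul,
      integral_const_mul, integral_const, smul_eq_mul, probReal_univ, one_mul]
  have hA : A =ᵐ[π] π[g | MeasurableSpace.comap (fun (ω : ι → X) (b : {b : ι // b ≠ i}) => ω b.1)
      MeasurableSpace.pi] := (condExp_pi_ae_eq_integral_update ρ i hgm hgi).symm
  have hAL2 : MemLp A 2 π := (hg.condExp (m := MeasurableSpace.comap
      (fun (ω : ι → X) (b : {b : ι // b ≠ i}) => ω b.1) MeasurableSpace.pi) one_le_two).ae_eq hA.symm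
  have hgA : Integrable (fun x => g x * A x) π := hg.integrable_mul hAL2
  have hI3 : Integrable (fun x => ∫ y, g (Function.update x i y) ^ 2 ∂ρ) π :=
    (integrable_comp_update ρ i hg2).integral_prod_left
  have hF : Integrable (fun x => g x ^ 2 - 2 * (g x * A x)) π := hg2.sub (hgA.const_mul 2)
  have hG : Integrable (fun x => 2 * (g x * A x)) π := hgA.const_mul 2
  rw [integral_congr_ae hpt, integral_add hF hI3, integral_sub hg2 hG, integral_const_mul,
    ← integral_pi_eq_integral_integral_update ρ i hg2]
  have hgA_eq : ∫ x, g x * A x ∂π = ∫ x, (π[g | MeasurableSpace.comap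
      (fun (ω : ι → X) (b : {b : ι // b ≠ i}) => ω b.1) MeasurableSpace.pi]) x ^ 2 ∂π := by
    rw [← integral_mul_condExp (comap_restrict_le (X := X) i) hg]
    exact integral_congr_ae (by filter_upwards [hA] with x hx; rw [hx])
  rw [hgA_eq]; ring

/-- **Efron–Stein, conditional-variance form** (Boucheron–Bousquet–Lugosi 2004, §2 Thm 4; from the tree's
resampling form `EfronSteinInequality_holds`, Thm 5, by `half_integral_sq_sub_update_eq`): for `g ∈ L²(ρ^{⊗ι})`,
`Var_π(g) ≤ Σ_i (∫ g² dπ − ∫ (π[g | σ(ω_b, b ≠ i)])² dπ)`. [cite: BoucheronBousquetLugosi2004, §2 Thm 4] -/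
theorem variance_pi_le_sum_condVar {g : (ι → X) → ℝ} (hgm : StronglyMeasurable g)
    (hg : MemLp g 2 (Measure.pi fun _ : ι => ρ)) :
    variance g (Measure.pi fun _ : ι => ρ) ≤
      ∑ i, ((∫ x, g x ^ 2 ∂Measure.pi (fun _ : ι => ρ))
        - ∫ x, ((Measure.pi fun _ : ι => ρ)[g | MeasurableSpace.comap
            (fun (ω : ι → X) (b : {b : ι // b ≠ i}) => ω b.1) MeasurableSpace.pi]) x ^ 2
          ∂Measure.pi (fun _ : ι => ρ)) := by
  have hES := Literature.Probability.Moments.EfronSteinInequality_holds ι (fun _ => X) (fun _ => ρ) g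
    hgm.measurable hg
  rw [Finset.mul_sum] at hES
  exact hES.trans (le_of_eq (Finset.sum_congr rfl fun i _ => half_integral_sq_sub_update_eq ρ i hgm hg))

end Product

/-! ### §3 Holley–Stroock comparison of one heat-bath term -/

section Comparison

variable {Ω : Type*} [MeasurableSpace Ω] {b : ℝ}

/-- Integrals of non-negative functions compare like the measures: `ν ≤ e^{b} ν'` gives
`∫ f dν ≤ e^{b} ∫ f dν'` for `f ≥ 0` `ν'`-integrable. [folklore] -/
theorem integral_le_exp_mul_integral_of_le_smul {ν ν' : Measure Ω} (hle : ν ≤ ENNReal.ofReal (Real.exp b) • ν')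
    {f : Ω → ℝ} (hf : 0 ≤ f) (hfi : Integrable f ν') :
    ∫ ω, f ω ∂ν ≤ Real.exp b * ∫ ω, f ω ∂ν' := by
  have h1 : ∫ ω, f ω ∂ν ≤ ∫ ω, f ω ∂(ENNReal.ofReal (Real.exp b) • ν') :=
    integral_mono_measure hle (Eventually.of_forall fun ω => hf ω) (hfi.smul_measure ENNReal.ofReal_ne_top)
  rwa [integral_smul_measure, ENNReal.toReal_ofReal (Real.exp_pos b).le, smul_eq_mul] at h1

end Comparison

section Perturbed

variable {Ω : Type*} {m mΩ : MeasurableSpace Ω} {π μ : Measure Ω} [IsProbabilityMeasure π] [IsProbabilityMeasure μ]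
  {b : ℝ}

/-- **Holley–Stroock for one heat-bath term**: if `π ≤ e^{b} μ` then for every sub-σ-algebra `m` and
`g ∈ L²(μ) ∩ L²(π)`, `∫ g² dπ − ∫ (π[g|m])² dπ ≤ e^{b} (∫ g² dμ − ∫ (μ[g|m])² dμ)`: the left side is
`∫ (g − π[g|m])² dπ ≤ ∫ (g − μ[g|m])² dπ` (the conditional expectation is the closest `m`-measurable function)
`≤ e^{b} ∫ (g − μ[g|m])² dμ`. [cite: HolleyStroock1987, Lemma (bounded perturbation)] -/
theorem condVar_integral_le_exp_mul (hm : m ≤ mΩ) (hle : π ≤ ENNReal.ofReal (Real.exp b) • μ) {g : Ω → ℝ}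
    (hgμ : MemLp g 2 μ) (hgπ : MemLp g 2 π) :
    (∫ ω, g ω ^ 2 ∂π) - ∫ ω, (π[g|m]) ω ^ 2 ∂π
      ≤ Real.exp b * ((∫ ω, g ω ^ 2 ∂μ) - ∫ ω, (μ[g|m]) ω ^ 2 ∂μ) := by
  have hPμ : MemLp (μ[g|m]) 2 μ := hgμ.condExp one_le_two
  have hPπ : MemLp (μ[g|m]) 2 π := hPμ.of_measure_le_smul ENNReal.ofReal_ne_top hle
  rw [← integral_sub_condExp_sq hm hgπ, ← integral_sub_condExp_sq hm hgμ]
  calc ∫ ω, (g ω - (π[g|m]) ω) ^ 2 ∂π ≤ ∫ ω, (g ω - (μ[g|m]) ω) ^ 2 ∂π :=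
        integral_sub_condExp_sq_le hm hgπ stronglyMeasurable_condExp hPπ
    _ ≤ Real.exp b * ∫ ω, (g ω - (μ[g|m]) ω) ^ 2 ∂μ :=
        integral_le_exp_mul_integral_of_le_smul hle (fun ω => sq_nonneg _) (hgμ.sub hPμ).integrable_sq

end Perturbed

end Summit.QuantumFields.YangMills.Theorems.UnitSamplerGap
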